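import Summits.ValiantsHypothesis.ValiantsHypothesis.Theorems.SymPencilPerFourTwoRowCorankTwo
import Summits.ValiantsHypothesis.ValiantsHypothesis.Theorems.SymPencilPerFourOneRowKernelPlane

/-!
# Route `SymPencil` — leaf R1N of the `(11, 5, 4)` cascade: the per-direction reading at a THREE-row direction
# (`--supports` stmt-ValiantsHypothesis-5674 `SdcSuperquadratic`; memo `SING-FIVE-CLASSIFICATION.md` §6.2 (I2)/(T1), for the
# residual `stub_R1N_residual` of `Cruxes/SdcSuperquadratic/Lines/sing_five_classification.lean`; rung currency only)

Setting (normalised): a direction `y ∈ K^{4×4}` with ZERO ROW `0` and live rows `a = y₁, b = y₂, c = y₃`.  The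
`s²`-coefficient of `per₄ (u + s y)` is the bilinear form `u₀ᵀ · (P(b,c) u₁ + P(a,c) u₂ + P(a,b) u₃)` between row `0`
of `u` and rows `1, 2, 3` of `u`, i.e. `u₀ᵀ N_y (u₁; u₂; u₃)` with the `4 × 12` matrix
`N_y = [P(y₂,y₃) | P(y₁,y₃) | P(y₁,y₂)]` of pairing matrices (`(P(v,w) e_m)_l = T3 e_m v w l`).

* `second_diff₀`, `sum_sq_eq_Q₀` — a per-direction family of squares at `y` represents exactly this form;
* `minors_three_rows` — under a family of `< 6` squares every `3 × 3` minor of `N_y` vanishes (rank `N_y ≤ 2`; the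
  `6`-variable block argument of ✓ `minors_of_sum_sq_swap_rows01`, which is the two-row case);
* (in the continuation `SymPencilPerFourOneRowReadingPairs`) the pairing matrix of ANY two live rows of such a `y` has
  corank `≥ 2`, so the two rows are STAR or BIPARTITE ((T1) of the memo, for three-row elements).

Honest framing: [folklore] linear algebra for ONE leaf of ONE of four open size-27 cells; leaf R1N and the cell file remain
OPEN; `27 ≤ sdc(per₄) ≤ 29` unchanged; the crux `SdcSuperquadratic` and `VP ≠ VNP` untouched; no summit statement is proved
here.  No definitions, no named facts.
-/

noncomputable section

set_option linter.dupNamespace false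

namespace Summit.ValiantsHypothesis.ValiantsHypothesis.Theorems.SymPencilPerFourOneRowReading

open Module MvPolynomial
open Literature.Computability.AlgebraicComplexity
open Summit.ValiantsHypothesis.ValiantsHypothesis.Theorems.SymPencilSingSixClassification
open Summit.ValiantsHypothesis.ValiantsHypothesis.Theorems.SymPencilPerFourOneRowKernelPlane
open Summit.ValiantsHypothesis.ValiantsHypothesis.Theorems.SymPencilPerFourTwoRowCorankTwo
open Summit.ValiantsHypothesis.ValiantsHypothesis.Theorems.SymPencilPerFourPairingMinors

variable {K : Type*} [Field K]

/-! ## 1. `T3` and finite sums -/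

/-- `T3` is additive over finite sums in its first slot. [folklore] -/
theorem T3_sum₁ {ι : Type*} (s : Finset ι) (f : ι → Fin 4 → K) (v w : Fin 4 → K) (l : Fin 4) :
    T3 (∑ t ∈ s, f t) v w l = ∑ t ∈ s, T3 (f t) v w l := by
  classical
  induction s using Finset.induction_on with
  | empty => simp [T3_zero₁]
  | insert a s ha ih => rw [Finset.sum_insert ha, Finset.sum_insert ha, T3_add₁, ih]

/-- `T3` is additive over finite sums in its second slot. [folklore] -/
theorem T3_sum₂ {ι : Type*} (s : Finset ι) (f : ι → Fin 4 → K) (u w : Fin 4 → K) (l : Fin 4) :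
    T3 u (∑ t ∈ s, f t) w l = ∑ t ∈ s, T3 u (f t) w l := by
  classical
  induction s using Finset.induction_on with
  | empty => simp [T3_zero₂]
  | insert a s ha ih => rw [Finset.sum_insert ha, Finset.sum_insert ha, T3_add₂, ih]

/-- `T3` is additive over finite sums in its third slot. [folklore] -/
theorem T3_sum₃ {ι : Type*} (s : Finset ι) (f : ι → Fin 4 → K) (u v : Fin 4 → K) (l : Fin 4) :
    T3 u v (∑ t ∈ s, f t) l = ∑ t ∈ s, T3 u v (f t) l := by
  classical
  induction s using Finset.induction_on with
  | empty => simp [T3_zero₃]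
  | insert a s ha ih => rw [Finset.sum_insert ha, Finset.sum_insert ha, T3_add₃, ih]

/-! ## 2. The `s²`-coefficient along a direction with zero row `0` -/

/-- **Second finite difference of `per₄` along a direction with zero row `0`**:
`per(u + y) + per(u − y) − 2 per u = 2 · u₀ᵀ (T3(u₁,y₂,y₃) + T3(y₁,u₂,y₃) + T3(y₁,y₂,u₃))`. [folklore] -/
theorem second_diff₀ (y : Fin 4 × Fin 4 → K) (hy : ∀ m, y (0, m) = 0) (u : Fin 4 × Fin 4 → K) :
    eval (u + y) (perPoly (Fin 4) K) + eval (u - y) (perPoly (Fin 4) K) - 2 * eval u (perPoly (Fin 4) K) =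
      2 * ∑ l, u (0, l) * (T3 (row u 1) (row y 2) (row y 3) l + T3 (row y 1) (row u 2) (row y 3) l +
        T3 (row y 1) (row y 2) (row u 3) l) := by
  have h0 := hy 0; have h1 := hy 1; have h2 := hy 2; have h3 := hy 3
  simp only [Fin.sum_univ_four, (T3_explicit _ _ _).1, (T3_explicit _ _ _).2.1, (T3_explicit _ _ _).2.2.1,
    (T3_explicit _ _ _).2.2.2, row, eval_perPoly, Matrix.permanent_fin_four_row, Matrix.of_apply, Pi.add_apply,
    Pi.sub_apply, h0, h1, h2, h3, add_zero, sub_zero]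
  ring

/-- **The three-row Hessian reading**: a per-direction family of squares at `y` (zero row `0`) represents exactly
the bilinear form of `second_diff₀`. [folklore] -/
theorem sum_sq_eq_Q₀ [CharZero K] (y : Fin 4 × Fin 4 → K) (hy : ∀ m, y (0, m) = 0)
    {ι : Type*} [Fintype ι] (c : ι → K) (Λ : ι → ((Fin 4 × Fin 4 → K) →ₗ[K] K))
    (h : ∀ u : Fin 4 × Fin 4 → K, ∃ e₀ e₁ : K, ∀ s : K,
      eval (u + s • y) (perPoly (Fin 4) K) = e₀ + s * e₁ + s ^ 2 * ∑ k, c k * (Λ k u) ^ 2)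
    (u : Fin 4 × Fin 4 → K) :
    ∑ k, c k * (Λ k u) ^ 2 = ∑ l, u (0, l) * (T3 (row u 1) (row y 2) (row y 3) l +
      T3 (row y 1) (row u 2) (row y 3) l + T3 (row y 1) (row y 2) (row u 3) l) := by
  obtain ⟨e₀, e₁, he⟩ := h u
  have h0 := he 0
  have h1 := he 1
  have h1' := he (-1)
  rw [zero_smul, add_zero] at h0
  rw [one_smul] at h1
  rw [neg_one_smul, ← sub_eq_add_neg] at h1'
  have hd := second_diff₀ y hy u
  have h2 : (2 : K) * ∑ k, c k * (Λ k u) ^ 2 = 2 * ∑ l, u (0, l) * (T3 (row u 1) (row y 2) (row y 3) l +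
      T3 (row y 1) (row u 2) (row y 3) l + T3 (row y 1) (row y 2) (row u 3) l) := by
    linear_combination hd - h1 - h1' + 2 * h0
  exact (mul_right_inj' two_ne_zero).1 h2

/-! ## 3. Every `3 × 3` minor of `N_y = [P(y₂,y₃) | P(y₁,y₃) | P(y₁,y₂)]` vanishes -/

/-- **Rank `N_y ≤ 2` under fewer than six squares.**  For a direction `y` with zero row `0` carrying a
per-direction family of `< 6` squares, every `3 × 3` minor of the `4 × 12` matrix
`N_y (l, (x, m)) = [T3 e_m y₂ y₃, T3 y₁ e_m y₃, T3 y₁ y₂ e_m]_x (l)` vanishes: a non-zero minor (rows `I`, columns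
`J`) gives a `6`-dimensional coordinate block (row `0` on `I`, the cells `(x+1, m)` of `J`) on which the form of
`sum_sq_eq_Q₀` is non-degenerate, while `< 6` squares have a common zero there. [folklore] -/
theorem minors_three_rows [CharZero K] {ι : Type*} [Fintype ι] (hι : Fintype.card ι < 6)
    (y : Fin 4 × Fin 4 → K) (hy : ∀ m, y (0, m) = 0) (c : ι → K)
    (Λ : ι → ((Fin 4 × Fin 4 → K) →ₗ[K] K))
    (h : ∀ u : Fin 4 × Fin 4 → K, ∃ e₀ e₁ : K, ∀ s : K,
      eval (u + s • y) (perPoly (Fin 4) K) = e₀ + s * e₁ + s ^ 2 * ∑ k, c k * (Λ k u) ^ 2)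
    (I : Fin 3 → Fin 4) (J : Fin 3 → Fin 3 × Fin 4) :
    ((Matrix.of fun (l : Fin 4) (p : Fin 3 × Fin 4) =>
        ![T3 (Pi.single p.2 1) (row y 2) (row y 3) l, T3 (row y 1) (Pi.single p.2 1) (row y 3) l,
          T3 (row y 1) (row y 2) (Pi.single p.2 1) l] p.1).submatrix I J).det = 0 := by
  classical
  set N : Matrix (Fin 4) (Fin 3 × Fin 4) K := Matrix.of fun (l : Fin 4) (p : Fin 3 × Fin 4) =>
    ![T3 (Pi.single p.2 1) (row y 2) (row y 3) l, T3 (row y 1) (Pi.single p.2 1) (row y 3) l,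
      T3 (row y 1) (row y 2) (Pi.single p.2 1) l] p.1 with hN
  by_contra hdet
  have hQ := sum_sq_eq_Q₀ y hy c Λ h
  -- the `6`-dimensional coordinate block: row `0` on the columns `I`, the cells `((J t).1 + 1, (J t).2)`
  let emb : ((Fin 3 → K) × (Fin 3 → K)) →ₗ[K] (Fin 4 × Fin 4 → K) :=
    { toFun := fun vw p => if p.1 = 0 then ∑ t, (if p.2 = I t then vw.1 t else 0)
        else ∑ t, (if p = ((J t).1.succ, (J t).2) then vw.2 t else 0)
      map_add' := fun x x' => by
        funext p
        simp only [Prod.fst_add, Prod.snd_add, Pi.add_apply]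
        split_ifs
        · rw [← Finset.sum_add_distrib]
          exact Finset.sum_congr rfl fun t _ => by split_ifs <;> simp
        · rw [← Finset.sum_add_distrib]
          exact Finset.sum_congr rfl fun t _ => by split_ifs <;> simp
      map_smul' := fun r x => by
        funext p
        simp only [Prod.smul_fst, Prod.smul_snd, Pi.smul_apply, smul_eq_mul, RingHom.id_apply]
        split_ifs
        · rw [Finset.mul_sum]
          exact Finset.sum_congr rfl fun t _ => by split_ifs <;> simp
        · rw [Finset.mul_sum]
          exact Finset.sum_congr rfl fun t _ => by split_ifs <;> simp }
  have hemb : ∀ (vw : (Fin 3 → K) × (Fin 3 → K)) (p : Fin 4 × Fin 4), emb vw p =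
      if p.1 = 0 then ∑ t, (if p.2 = I t then vw.1 t else 0)
        else ∑ t, (if p = ((J t).1.succ, (J t).2) then vw.2 t else 0) := fun vw p => rfl
  have hrow0 : ∀ vw : (Fin 3 → K) × (Fin 3 → K), ∀ l, emb vw (0, l) = ∑ t, (if l = I t then vw.1 t else 0) :=
    fun vw l => by rw [hemb]; simp
  have hrowS : ∀ vw : (Fin 3 → K) × (Fin 3 → K), ∀ x : Fin 3, row (emb vw) x.succ =
      ∑ t, (if (J t).1 = x then vw.2 t • (Pi.single (J t).2 1 : Fin 4 → K) else 0) := by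
    intro vw x
    funext m
    rw [Finset.sum_apply]
    simp only [row, hemb, Fin.succ_ne_zero, if_false]
    refine Finset.sum_congr rfl fun t _ => ?_
    by_cases hx : (J t).1 = x
    · rw [if_pos hx]
      by_cases hm : m = (J t).2
      · rw [if_pos (by rw [hx, hm]), hm]; simp
      · rw [if_neg (fun h' => hm (Prod.mk.inj h').2)]
        simp [hm]
    · rw [if_neg hx, if_neg (fun h' => hx (Fin.succ_inj.1 (Prod.mk.inj h').1).symm)]
      simp
  -- the three `T3` terms on the block
  have hG : ∀ (vw : (Fin 3 → K) × (Fin 3 → K)) (l : Fin 4),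
      T3 (row (emb vw) 1) (row y 2) (row y 3) l + T3 (row y 1) (row (emb vw) 2) (row y 3) l +
        T3 (row y 1) (row y 2) (row (emb vw) 3) l = ∑ t, vw.2 t * N l (J t) := by
    intro vw l
    have e1 : (1 : Fin 4) = (0 : Fin 3).succ := rfl
    have e2 : (2 : Fin 4) = (1 : Fin 3).succ := rfl
    have e3 : (3 : Fin 4) = (2 : Fin 3).succ := rfl
    rw [e1, e2, e3, hrowS, hrowS, hrowS, T3_sum₁, T3_sum₂, T3_sum₃, ← Finset.sum_add_distrib,
      ← Finset.sum_add_distrib]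
    refine Finset.sum_congr rfl fun t _ => ?_
    have key : ∀ p : Fin 3 × Fin 4,
        T3 (if p.1 = 0 then vw.2 t • (Pi.single p.2 1 : Fin 4 → K) else 0) (row y 2) (row y 3) l +
          T3 (row y 1) (if p.1 = 1 then vw.2 t • (Pi.single p.2 1 : Fin 4 → K) else 0) (row y 3) l +
          T3 (row y 1) (row y 2) (if p.1 = 2 then vw.2 t • (Pi.single p.2 1 : Fin 4 → K) else 0) l =
        vw.2 t * N l p := by
      rintro ⟨x, m⟩
      fin_cases x
      · simp [hN, T3_smul₁, T3_zero₂, T3_zero₃]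
      · simp [hN, T3_smul₂, T3_zero₁, T3_zero₃]
      · simp [hN, T3_smul₃, T3_zero₁, T3_zero₂]
    exact key (J t)
  -- the form on the block is the pairing through `N_{IJ}`
  have hpair : ∀ vw : (Fin 3 → K) × (Fin 3 → K),
      ∑ l, emb vw (0, l) * (T3 (row (emb vw) 1) (row y 2) (row y 3) l +
        T3 (row y 1) (row (emb vw) 2) (row y 3) l + T3 (row y 1) (row y 2) (row (emb vw) 3) l) =
        dotProduct vw.1 ((N.submatrix I J).mulVec vw.2) := by
    intro vw
    simp_rw [hG, hrow0]
    rw [sum_extend_mul I vw.1 (fun l => ∑ t, vw.2 t * N l (J t))]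
    simp only [dotProduct, Matrix.mulVec, Matrix.submatrix_apply]
    refine Finset.sum_congr rfl fun t _ => ?_
    congr 1
    exact Finset.sum_congr rfl fun t' _ => mul_comm _ _
  -- a common zero of the `Λ_k` in the block
  let L : ((Fin 3 → K) × (Fin 3 → K)) →ₗ[K] (ι → K) := LinearMap.pi fun k => (Λ k).comp emb
  have hker : LinearMap.ker L ≠ ⊥ :=
    LinearMap.ker_ne_bot_of_finrank_lt (by
      rw [finrank_prod, finrank_fintype_fun_eq_card, finrank_fintype_fun_eq_card,
        Fintype.card_fin]
      omega)
  obtain ⟨x₀, hx₀, hx₀ne⟩ := Submodule.exists_mem_ne_zero_of_ne_bot hker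
  have hΛ : ∀ k, Λ k (emb x₀) = 0 := fun k => by
    have := congr_fun (LinearMap.mem_ker.1 hx₀) k
    simpa [L] using this
  -- translation invariance of the form by `emb x₀`
  have hinv : ∀ x : (Fin 3 → K) × (Fin 3 → K),
      dotProduct (x₀.1 + x.1) ((N.submatrix I J).mulVec (x₀.2 + x.2)) = dotProduct x.1 ((N.submatrix I J).mulVec x.2) := by
    intro x
    have h1 := hQ (emb (x₀ + x))
    have h2 := hQ (emb x)
    rw [hpair] at h1 h2
    rw [map_add] at h1
    simp_rw [LinearMap.map_add, hΛ, zero_add] at h1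
    rw [Prod.fst_add, Prod.snd_add] at h1
    rw [← h1, ← h2]
  have h00 : dotProduct x₀.1 ((N.submatrix I J).mulVec x₀.2) = 0 := by
    have h' := hinv (0, 0)
    simpa using h'
  have hv : x₀.1 = 0 := by
    apply Matrix.eq_zero_of_vecMul_eq_zero hdet
    funext t
    have h := hinv (0, Pi.single t 1)
    simp only [add_zero, zero_dotProduct] at h
    rw [Matrix.mulVec_add, dotProduct_add, h00, zero_add, Matrix.dotProduct_mulVec,
      dotProduct_single, mul_one] at h
    rw [h, Pi.zero_apply]
  have hw : x₀.2 = 0 := by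
    apply Matrix.eq_zero_of_mulVec_eq_zero hdet
    funext t
    have h := hinv (Pi.single t 1, 0)
    simp only [add_zero, dotProduct_zero, Matrix.mulVec_zero] at h
    rw [add_dotProduct, h00, zero_add, single_dotProduct, one_mul] at h
    rw [h, Pi.zero_apply]
  exact hx₀ne (Prod.ext hv hw)

end Summit.ValiantsHypothesis.ValiantsHypothesis.Theorems.SymPencilPerFourOneRowReading
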